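import Summits.BirchSwinnertonDyer.BirchSwinnertonDyer.Theorems.KimAtThreeD7uTamagawaCore
import HarnessLib

/-!
# The TAMAGAWA-DIVISIBLE bad places, II: `φ − 1` is ONTO the `p`-divisible core of `E[p^∞]^{I_v}`
# (`H¹(⟨φ⟩, core) = 0`)
# (cell `bsd-addord`, seat w2-tamdiv gen 4; route W2 `KimAtThreeKolyvagin`, items 19562 / 19560, «TamDiv∞»,
# POSITIVE exponent)

HONEST FRAMING: TOOL theorem (no definition, no named fact, no `sorry`); closes nothing by itself;
nothing is booked; BSD is not proved by any of this.  Continues `KimAtThreeD7uTamagawaCore` (the core of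
`N = E[p^∞]^{I_{𝔓₀}}` = the points with `I`-fixed `p^k`-th roots for all `k`; `p`-divisible, `D`-stable,
`π_n(T_pE^{I}) = core[p^n]`).

## What (any number field `K`, `𝔓₀ = adicCompletionPrime K v`, `v ∤ p`, `φ` an arithmetic Frobenius at `𝔓₀`)

**`exists_core_frob_smul_sub_eq`: `φ − 1` maps the core ONTO the core.**  The core `C` is a `φ`-stable
`p`-divisible `p`-primary group whose `φ`-fixed part `C^{φ}` lies in the `D_{𝔓₀}`-fixed torsion
`E(K_v)[p^∞]`, a finite set (`finite_setOf_forall_decompositionSubgroup_smul_eq`); with `e = #C^{φ}`: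
(a) `C` is `e`-divisible (`e = p^a u`, `p ∤ u`: `p^a`-th roots by divisibility, `u` acts invertibly on
`p`-primary torsion); (b) on each finite layer `B = C[p^N]`, `φ − 1` is an endomorphism with kernel
`⊆ C^{φ}`, so `[B : (φ−1)B] = #ker ∣ e` and `e • B ⊆ (φ−1)B`; hence every `m = e • z ∈ C` is `(φ−1)b`,
`b ∈ B ⊆ C`.  (For `C ≅ (ℚ_p/ℤ_p)^a`: an endomorphism with finite kernel is onto; this is
`H¹(D/I, C) = C/(φ−1)C = 0`, Milne *ADT* I §2.)  It is the reason the Tamagawa quotient `(N/C)^{φ}` is the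
image of `N^{φ} = E(K_v)[p^∞]` (sequel `KimAtThreeD7uTamagawaComponent`), i.e. why the positive-exponent
index `[𝓕_can(w) : 𝓕_u(w)]` is governed by `E(K_v)[p^∞]/E₀(K_v)[p^∞] ≅ Φ_v[p^∞]` (Rubin, *Euler Systems*,
Lemma 1.3.5; Büyükboduk, JNT 129 (2009) §2.1.2 Remark 2; [MR04] Prop. 6.2.6).
References: R. Greenberg, LNM 1716 (1999) §3 Lemma 3.3 (proof, p. 87); J. S. Milne, *ADT* I §2, Prop. 3.8;
K. Rubin, *Euler Systems* (2000) Lemma 1.3.2, 1.3.5.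
-/

noncomputable section

-- the cell's Theorems namespace `Summit.BirchSwinnertonDyer.BirchSwinnertonDyer.…` repeats the summit name by design (D-0017)
set_option linter.dupNamespace false

open Function Field IsDedekindDomain NumberField
open scoped NumberField Classical
open Literature.NumberTheory.GaloisRepresentations Literature.NumberTheory.EllipticCurves
open WeierstrassCurve
open Summit.BirchSwinnertonDyer.Rank1Residual.GaloisImage
open Summit.BirchSwinnertonDyer.Rank1Residual.GaloisImage.InertiaDivisible

namespace Summit.BirchSwinnertonDyer.BirchSwinnertonDyer.Theorems.KimAtThreeD7uTamagawaCore

variable {K : Type} [Field K] [NumberField K] (W : WeierstrassCurve K) [W.IsElliptic] (p : ℕ)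
  [hp : Fact p.Prime]

/-! ### §3 `φ − 1` is ONTO the core (`H¹(⟨φ⟩, core) = 0`) -/

section Frobenius

variable {v : HeightOneSpectrum (𝓞 K)}

/-- **`φ − 1` maps the core of `E[p^∞]^{I_{𝔓₀}}` ONTO itself** (`v ∤ p`, `φ` an arithmetic Frobenius at
`𝔓₀`).  The core `C` is a `φ`-stable `p`-divisible `p`-primary group whose `φ`-fixed part `C^{φ}` is
contained in the `D_{𝔓₀}`-fixed torsion `E(K_v)[p^∞]`, a finite set
(`finite_setOf_forall_decompositionSubgroup_smul_eq`); put `e = #C^{φ}`.  (a) `C` is `e`-divisible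
(`e = p^a u`, `p ∤ u`: `p^a`-th roots by divisibility, `u` acts invertibly on `p`-primary torsion).
(b) On each finite layer `B = C[p^N]`, `φ − 1` is an endomorphism with kernel `⊆ C^{φ}`, so
`[B : (φ−1)B] = #ker ∣ e` and `e • B ⊆ (φ−1)B`.  Hence `m = e • z ∈ (φ−1)C` for every `m ∈ C`.
(For `C ≅ (ℚ_p/ℤ_p)^a`: an endomorphism with finite kernel is onto; Milne *ADT* I §2, `H¹(Ẑ, C) = C/(φ−1)C`.)
[cite: GreenbergLNM1716, §3 Lemma 3.3 (proof, p. 87)] [cite: MilneADT2006, Ch. I §2 (unramified cohomology)] -/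
theorem exists_core_frob_smul_sub_eq (hpv : (p : 𝓞 K) ∉ v.asIdeal)
    {φ : absoluteGaloisGroup K} (hφ : IsArithFrobAt (𝓞 K) φ (adicCompletionPrime K v))
    (m : W.geomPrimaryTorsion p)
    (hm : ∀ k : ℕ, ∃ y : W.geomPrimaryTorsion p,
      (∀ i ∈ (adicCompletionPrime K v).inertia (absoluteGaloisGroup K), i • y = y) ∧ p ^ k • y = m) :
    ∃ b : W.geomPrimaryTorsion p,
      (∀ k : ℕ, ∃ y : W.geomPrimaryTorsion p,
        (∀ i ∈ (adicCompletionPrime K v).inertia (absoluteGaloisGroup K), i • y = y) ∧ p ^ k • y = b) ∧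
      φ • b - b = m := by
  have hpp : p.Prime := hp.out
  set I : Subgroup (absoluteGaloisGroup K) := (adicCompletionPrime K v).inertia (absoluteGaloisGroup K)
    with hIdef
  have hφD : φ ∈ (adicCompletionPrime K v).decompositionSubgroup (absoluteGaloisGroup K) :=
    hφ.mem_stabilizer
  -- the core as a subgroup `C`
  let P : W.geomPrimaryTorsion p → Prop := fun x => ∀ k : ℕ, ∃ y : W.geomPrimaryTorsion p,
    (∀ i ∈ I, i • y = y) ∧ p ^ k • y = x
  let C : AddSubgroup (W.geomPrimaryTorsion p) :=
    { carrier := {x | P x}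
      add_mem' := fun {a b} ha hb => core_add W p ha hb
      zero_mem' := core_zero W p
      neg_mem' := fun {a} ha => core_neg W p ha }
  have hCmem : ∀ x : W.geomPrimaryTorsion p, x ∈ C ↔ P x := fun _ => Iff.rfl
  -- every point of `E[p^∞]` is `p`-primary
  have htors : ∀ x : W.geomPrimaryTorsion p, ∃ n : ℕ, p ^ n • x = 0 := fun x => by
    obtain ⟨n, hn⟩ := (AddCommGroup.mem_primaryComponent).mp x.2
    exact ⟨n, Subtype.ext (by rw [AddSubmonoidClass.coe_nsmul, ZeroMemClass.coe_zero]; exact hn)⟩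
  -- `f = φ − 1` on `C`
  let f : C →+ C :=
    { toFun := fun x => ⟨φ • (x : W.geomPrimaryTorsion p) - x,
        core_sub W p (core_smul_of_mem_decompositionSubgroup W p x.2 hφD) x.2⟩
      map_zero' := Subtype.ext (by simp)
      map_add' := fun a b => Subtype.ext (by
        simp only [AddSubgroup.coe_add, smul_add]; abel) }
  have hf : ∀ x : C, ((f x : C) : W.geomPrimaryTorsion p) = φ • (x : W.geomPrimaryTorsion p) - x :=
    fun _ => rfl
  -- the kernel `C^{φ}` is finite
  have hfinD := finite_setOf_forall_decompositionSubgroup_smul_eq W p hpv (v := v)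
  set Dfix : Set (W.geomPrimaryTorsion p) := {t : W.geomPrimaryTorsion p |
      ∀ d ∈ (adicCompletionPrime K v).decompositionSubgroup (absoluteGaloisGroup K), d • t = t}
    with hDfix
  haveI hKfin : Finite f.ker := by
    have hval : ∀ x : f.ker, ((x : C) : W.geomPrimaryTorsion p) ∈ Dfix := fun x d hd =>
      smul_eq_of_mem_decompositionSubgroup_of_inertia_of_frob W p v hφ
        (fun i hi => smul_eq_of_core W p (x : C).2 hi)
        (sub_eq_zero.mp (by
          have h := (AddMonoidHom.mem_ker).mp x.2
          have h' := congrArg (fun z : C => (z : W.geomPrimaryTorsion p)) h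
          simpa only [hf, ZeroMemClass.coe_zero] using h')) hd
    let g : f.ker → Dfix := fun x => ⟨((x : C) : W.geomPrimaryTorsion p), hval x⟩
    haveI := hfinD.to_subtype
    refine Finite.of_injective g fun a b hab => ?_
    have h : ((a : C) : W.geomPrimaryTorsion p) = ((b : C) : W.geomPrimaryTorsion p) :=
      congrArg (fun z : Dfix => (z : W.geomPrimaryTorsion p)) hab
    exact Subtype.ext (Subtype.ext h)
  haveI : Nonempty f.ker := ⟨0⟩
  set e : ℕ := Nat.card f.ker with hedef
  have he0 : e ≠ 0 := (Nat.card_pos (α := f.ker)).ne'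
  -- (a) `C` is `e`-divisible
  have hdivC : ∀ x : C, ∃ z : C, e • z = x := by
    intro x
    obtain ⟨a, u, hu, heq⟩ := Nat.exists_eq_pow_mul_and_not_dvd he0 p hpp.ne_one
    -- `p^a`-th root in `C`
    have hroot : ∀ (j : ℕ) (y : C), ∃ r : C, p ^ j • r = y := by
      intro j
      induction j with
      | zero => exact fun y => ⟨y, by rw [pow_zero, one_smul]⟩
      | succ j ih =>
        intro y
        obtain ⟨r, hr⟩ := ih y
        obtain ⟨r', hr'c, hr'⟩ := exists_core_nsmul_eq_of_core W p r.2
        refine ⟨⟨r', hr'c⟩, ?_⟩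
        rw [pow_succ, mul_smul]
        have : p • (⟨r', hr'c⟩ : C) = r := Subtype.ext hr'
        rw [this, hr]
    obtain ⟨r, hr⟩ := hroot a x
    -- `u` acts invertibly: `u c ≡ 1 mod p^N` with `p^N • r = 0`
    obtain ⟨N, hN⟩ := htors (r : W.geomPrimaryTorsion p)
    have hcop : Nat.Coprime u (p ^ N) :=
      (Nat.Coprime.pow_right N ((Nat.Prime.coprime_iff_not_dvd hpp).mpr hu).symm)
    by_cases hN1 : p ^ N = 1
    · -- then `r = 0`-torsion level is trivial: `1 • r = 0`, so `r = 0` and `x = 0`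
      have hr0 : (r : W.geomPrimaryTorsion p) = 0 := by rw [← one_smul ℕ (r : W.geomPrimaryTorsion p), ← hN1, hN]
      refine ⟨0, ?_⟩
      rw [smul_zero, ← hr]
      have : (r : C) = 0 := Subtype.ext hr0
      rw [this, smul_zero]
    · have h1 : 1 < p ^ N := by
        have := Nat.one_le_pow N p hpp.pos
        omega
      obtain ⟨c, -, hc⟩ := Nat.exists_mul_mod_eq_one_of_coprime hcop h1
      -- `(u c) • r = r`
      have key : (u * c) • r = r := by
        apply Subtype.ext
        rw [AddSubgroup.coe_nsmul]
        conv_lhs => rw [← Nat.mod_add_div (u * c) (p ^ N), hc]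
        rw [add_smul, one_smul, mul_comm, mul_smul, hN, smul_zero, add_zero]
      refine ⟨c • r, ?_⟩
      rw [heq, ← hr, smul_smul, mul_assoc, ← smul_smul (p ^ a) (u * c), key]
  -- (b) on the layer `B = C[p^N]`, `e • B ⊆ f(B)`
  have hlayer : ∀ (N : ℕ) (z : C), p ^ N • z = 0 → ∃ b : C, f b = e • z := by
    intro N z hz
    let B : AddSubgroup C := AddSubgroup.torsionBy C (p ^ N)
    have hBmem : ∀ y : C, y ∈ B ↔ p ^ N • y = 0 := fun y => AddSubgroup.torsionBy.nsmul_iff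
    have hfB : ∀ y : C, y ∈ B → f y ∈ B := fun y hy => by
      rw [hBmem] at hy ⊢
      rw [← map_nsmul, hy, map_zero]
    let g : B →+ B :=
      { toFun := fun y => ⟨f y, hfB _ y.2⟩
        map_zero' := Subtype.ext (map_zero f)
        map_add' := fun a b => Subtype.ext (map_add f _ _) }
    have hg : ∀ y : B, ((g y : B) : C) = f y := fun _ => rfl
    -- `B` is finite (it embeds in the `p^N`-torsion of `E(K̄)`)
    haveI hBfin : Finite B := by
      have hne : ((p ^ N : ℕ) : ℤ) ≠ 0 := by exact_mod_cast pow_ne_zero N hpp.ne_zero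
      haveI : Finite (geomTorsion W ((p ^ N : ℕ) : ℤ)) :=
        finite_torsionPoints_holds W (AlgebraicClosure K) hne
      let ι : B → geomTorsion W ((p ^ N : ℕ) : ℤ) := fun y =>
        ⟨(((y : C) : W.geomPrimaryTorsion p) : geomPoints W), by
          rw [mem_geomTorsion_iff, natCast_zsmul]
          have h := (hBmem _).mp y.2
          have h' := congrArg (fun z : C => ((z : W.geomPrimaryTorsion p) : geomPoints W)) h
          simpa only [AddSubgroup.coe_nsmul, AddSubmonoidClass.coe_nsmul, ZeroMemClass.coe_zero,
            AddSubgroup.coe_zero] using h'⟩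
      refine Finite.of_injective ι fun a b hab => ?_
      have h := congrArg (fun z : geomTorsion W ((p ^ N : ℕ) : ℤ) => (z : geomPoints W)) hab
      exact Subtype.ext (Subtype.ext (Subtype.ext h))
    -- `[B : g(B)] = #ker g ∣ e`
    haveI : Nonempty g.range := ⟨0⟩
    have hidx : g.range.index = Nat.card g.ker := by
      have h1 : Nat.card B = Nat.card g.ker * Nat.card g.range := by
        rw [← Nat.card_congr (QuotientAddGroup.quotientKerEquivRange g).toEquiv, mul_comm]
        exact AddSubgroup.card_eq_card_quotient_mul_card_addSubgroup g.ker
      have h2 : Nat.card B = g.range.index * Nat.card g.range :=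
        (AddSubgroup.index_mul_card g.range).symm
      have hr0 : Nat.card g.range ≠ 0 := (Nat.card_pos (α := g.range)).ne'
      exact Nat.eq_of_mul_eq_mul_right (Nat.pos_of_ne_zero hr0) (h2.symm.trans h1)
    have hdvd : g.range.index ∣ e := by
      rw [hidx, hedef]
      let κ : g.ker →+ f.ker :=
        { toFun := fun y => ⟨((y : B) : C), by
            have h := (AddMonoidHom.mem_ker).mp y.2
            have h' := congrArg (fun z : B => (z : C)) h
            rw [hg] at h'
            exact (AddMonoidHom.mem_ker).mpr h'⟩
          map_zero' := Subtype.ext rfl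
          map_add' := fun a b => Subtype.ext rfl }
      refine AddSubgroup.card_dvd_of_injective κ fun a b hab => ?_
      have h := congrArg (fun z : f.ker => (z : C)) hab
      exact Subtype.ext (Subtype.ext h)
    obtain ⟨t, ht⟩ := hdvd
    have hzB : z ∈ B := (hBmem z).mpr hz
    have hmem : g.range.index • (⟨z, hzB⟩ : B) ∈ g.range := AddSubgroup.nsmul_index_mem g.range _
    have hmem' : e • (⟨z, hzB⟩ : B) ∈ g.range := by
      rw [ht, mul_comm, mul_smul]
      exact g.range.nsmul_mem hmem t
    obtain ⟨y, hy⟩ := hmem'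
    refine ⟨(y : C), ?_⟩
    have h := congrArg (fun w : B => (w : C)) hy
    simpa only [hg, AddSubgroup.coe_nsmul] using h
  -- conclusion
  have hmC : (m : W.geomPrimaryTorsion p) ∈ C := (hCmem m).mpr hm
  obtain ⟨z, hz⟩ := hdivC ⟨m, hmC⟩
  obtain ⟨N, hN⟩ := htors (z : W.geomPrimaryTorsion p)
  obtain ⟨b, hb⟩ := hlayer N z (Subtype.ext (by rw [AddSubgroup.coe_nsmul, hN, AddSubgroup.coe_zero]))
  refine ⟨(b : W.geomPrimaryTorsion p), b.2, ?_⟩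
  rw [← hf, hb, hz]

end Frobenius

end Summit.BirchSwinnertonDyer.BirchSwinnertonDyer.Theorems.KimAtThreeD7uTamagawaCore

end
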